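import Mathlib
import Summits.ValiantsHypothesis.ValiantsHypothesis.Theorems.BarrierLeverPartitionMinorsHitByVPHiddenStatesPathTableStaircase
import Summits.ValiantsHypothesis.ValiantsHypothesis.Theorems.BarrierLeverPartitionMinorsHitByVPHiddenStatesPathTableTransfer
import Summits.ValiantsHypothesis.ValiantsHypothesis.Theorems.BarrierLeverPartitionMinorsHitByVPHiddenStatesPathTablePeel
import Summits.ValiantsHypothesis.ValiantsHypothesis.Theorems.BarrierLeverPartitionMinorsHitByVPHiddenStatesPathTable
import Summits.ValiantsHypothesis.ValiantsHypothesis.Theorems.BarrierLeverPartitionMinorsHitByVPHiddenStatesPathTableRows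
import Summits.ValiantsHypothesis.ValiantsHypothesis.Theorems.BarrierLeverPartitionMinorsHitByVPHiddenStatesPathTableLevels

/-!
# Route BarrierLever — item `PartitionMinorsHitByVP` (stmt-ValiantsHypothesis-19717), line `hidden-states`:
# ★★ `P_k` IS GOOD FOR EVERY `k` — THEOREM B (Ω-recursion) and the nonsingularity of the path-table matrix

Helper file (`--supports stmt-ValiantsHypothesis-19717`; cell valiant-natproofs, 𝒟-side door (c), registered line
`Cruxes/PartitionMinorsHitByVP/Lines/hidden_states.lean` v8; prover seat val-np-p6 gen 16).  Closes NO item; definition-free.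
Memo HOME/val-np-p6/g16/MEMO-valnp6-g16.md §3 in the kernel:
* `omega_eq` — the Ω-RECURSION SOLVED: `Σ_{φ ∈ maps (Yj j)} wt(φ)·Gj j c (image φ) = −2^j (−s)^c` for `1 ≤ j ≤ k−1`, `c ≥ j−1`
  (base: the two level-0 X-elements; step: `Ω(j+1,c) = Ω(j,c) − s(−s)^{c−j} Ω(j,j−1)` by the insertion laws (α)(β)(γ)).
* `top_sum`, `zk_insert_eq_Gj` — peeling the two top Y-coordinates `k`, `k−1` of the row `Y`.
* ★ `lambda_Y_ne_zero` — THEOREM B: `Σ_{φ ∈ maps Y} wt(φ)·zk (Y.image φ) = s·(−2^{k−1})(−s)^{k−1} ≠ 0`.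
* ★★ `pathTable_det_ne_zero` — for every `k ≥ 2` and `s ≠ 0`: every square matrix whose rows enumerate injectively rows of
  `U = {|S| ≤ k, S ≠ X} ∪ {Y}` and whose columns run through all points `|J| ≤ k`, with entries `∏_{a∈S} Σ_{q∈J} pw k s a q`
  (the block-additive hidden-state matrix of the ONE-PIECE design with the path table), has NONZERO DETERMINANT — the class
  `P_k = (B_k(2k+1); B_k − X + Xᶜ)` of the FIRST SHELL of HALF-BALL is served for EVERY `k` (`det_ne_zero_of_dual` with (hA) =
  `lambda_row_eq_zero`, (hB) = `lambda_Y_ne_zero`).  Exact checks of the value `(−1)^k 2^{k−1} s^k`: memo §4 (k ≤ 8).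

HONEST LABEL: a kernel theorem about ONE class of lower families per `k` (the smallest open instances of the GC½ column, by g15's
exact-section reduction the whole first shell ∀t on paper); the re-indexing to the item's `Fin (2k+1)` / `tx` currency is the sequel;
19717 stays OPEN; nothing on crux 14610 or VP ≠ VNP.
-/

set_option linter.dupNamespace false

namespace Summit.ValiantsHypothesis.ValiantsHypothesis.Theorems.BarrierLever.HiddenStates

open Finset

noncomputable section

namespace PathTable

variable {k : ℕ} {s : ℂ}

/-- ★ **The Ω-recursion solved** (memo §3, Theorem B's engine): for `1 ≤ j`, `j + 1 ≤ k` and `c ≥ j − 1`,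
`Σ_{φ ∈ maps (Yj j)} wt(φ) · Gj j c ((Yj j).image φ) = −2^j (−s)^c`. -/
theorem omega_eq (hk : 2 ≤ k) :
    ∀ j : ℕ, 1 ≤ j → j + 1 ≤ k → ∀ c : ℕ, j - 1 ≤ c →
      ∑ φ ∈ Fintype.piFinset (fun a => if a ∈ Yj k j then (Finset.univ : Finset (Fin (k + 1) ⊕ Fin k)) else {a}),
        (∏ a ∈ Yj k j, pw k s a (φ a)) * Gj k s j c ((Yj k j).image φ) = -2 ^ j * (-s) ^ c := by
  classical
  intro j hj
  induction j, hj using Nat.le_induction with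
  | base =>
    intro _ c _
    -- `Yj 1 = {inl 0}`: peel it off the empty set
    obtain ⟨hY1, h0⟩ := Yj_succ (k := k) (j := 0) (by omega)
    have hY0 : Yj k 0 = ∅ := by ext x; simp [Yj]
    rw [hY0] at hY1 h0
    rw [hY1, sum_maps_insert (pw k s) (Gj k s 1 c) h0]
    simp only [Finset.prod_empty, Finset.image_empty, one_mul, Finset.sum_const, Fintype.card_piFinset,
      Finset.notMem_empty, if_false, Finset.card_singleton, Finset.prod_const_one, one_smul]
    -- the inner sum over the sources of `inl 0`
    rw [Fintype.sum_sum_type]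
    have hinl : ∑ b : Fin (k + 1), pw k s (Sum.inl (⟨0, by omega⟩ : Fin (k + 1))) (Sum.inl b) *
        Gj k s 1 c (insert (Sum.inl b) ∅) = 0 := by
      refine Finset.sum_eq_zero fun b _ => ?_
      simp only [pw]
      by_cases hb : b = ⟨0, by omega⟩
      · subst hb
        rw [if_pos rfl, one_mul]
        -- both level-0 X-elements are missing: the guard fails
        unfold Gj
        rw [if_neg]
        intro hg
        have hinj := Finset.injOn_of_card_image_eq (f := lvlX k) (s := Xlt k 1 \ (insert (Sum.inl (⟨0, by omega⟩ :
          Fin (k + 1))) (∅ : Finset (Fin (k + 1) ⊕ Fin k))).toRight) (by unfold Lj at hg; exact hg.symm)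
        have h0 : (⟨0, by omega⟩ : Fin k) ∈ Xlt k 1 \ (insert (Sum.inl (⟨0, by omega⟩ : Fin (k + 1)))
            (∅ : Finset (Fin (k + 1) ⊕ Fin k))).toRight := by simp [Xlt, lvlX]
        have h1 : (⟨1, by omega⟩ : Fin k) ∈ Xlt k 1 \ (insert (Sum.inl (⟨0, by omega⟩ : Fin (k + 1)))
            (∅ : Finset (Fin (k + 1) ⊕ Fin k))).toRight := by simp [Xlt, lvlX]
        have := hinj (Finset.mem_coe.2 h0) (Finset.mem_coe.2 h1) (by simp [lvlX])
        simp [Fin.ext_iff] at this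
      · rw [if_neg hb, if_neg, zero_mul]
        intro h
        have : ((⟨0, by omega⟩ : Fin (k + 1)) : ℕ) = 0 := rfl
        omega
    have hinr : ∀ i : Fin k, pw k s (Sum.inl (⟨0, by omega⟩ : Fin (k + 1))) (Sum.inr i) *
        Gj k s 1 c (insert (Sum.inr i) ∅) = if (i : ℕ) < 2 then -((-s) ^ c) else 0 := by
      intro i
      simp only [pw]
      by_cases hi : (i : ℕ) < 2
      · rw [if_pos (by simp [lvlX]; omega), if_pos hi, one_mul]
        -- exactly one level-0 element missing
        have hset : Xlt k 1 \ (insert (Sum.inr i) (∅ : Finset (Fin (k + 1) ⊕ Fin k))).toRight =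
            {(⟨1 - (i : ℕ), by omega⟩ : Fin k)} := by
          ext x
          have htr : (insert (Sum.inr i) (∅ : Finset (Fin (k + 1) ⊕ Fin k))).toRight = {i} := by
            ext y; simp
          rw [htr, Finset.mem_sdiff, Finset.mem_singleton, Finset.mem_singleton]
          simp only [Xlt, lvlX, Finset.mem_filter, Finset.mem_univ, true_and]
          constructor
          · rintro ⟨h1, h2⟩
            have : (x : ℕ) ≠ (i : ℕ) := fun h => h2 (Fin.ext h)
            exact Fin.ext (by simp; omega)
          · intro h
            have hx : (x : ℕ) = 1 - (i : ℕ) := by rw [h]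
            refine ⟨by omega, fun h' => ?_⟩
            rw [h'] at hx; omega
        have hL : Lj k 1 (insert (Sum.inr i) ∅) = {0} := by
          unfold Lj; rw [hset]; simp [lvlX]
        have hA : Aset k (insert (Sum.inr i) (∅ : Finset (Fin (k + 1) ⊕ Fin k))) = ∅ := by
          simp [Aset]; ext; simp
        unfold Gj
        rw [if_pos (by rw [hL, hset]; simp), hL, hA]
        have := zetaLA_insert_top s (L := ∅) (A := ∅) (ℓ₀ := 0) (c := c) (by simp) (by simp)
        rw [Finset.insert_empty] at this
        rw [this, if_pos ⟨by simp, Nat.zero_le _⟩, zetaLA_empty, Nat.sub_zero, one_mul]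
      · rw [if_neg (by simp [lvlX]; omega), if_neg hi, zero_mul]
    rw [hinl, zero_add, Finset.sum_congr rfl fun i _ => hinr i, Finset.sum_ite, Finset.sum_const_zero, add_zero,
      Finset.sum_const, Fin.card_filter_val_lt]
    rw [Nat.min_eq_right hk, nsmul_eq_mul]
    ring
  | succ j hj ih =>
    intro hjk c hc
    have hjk' : j + 1 < k := by omega
    obtain ⟨hYs, hnot⟩ := Yj_succ (k := k) (j := j) (by omega)
    rw [hYs, sum_maps_insert (pw k s) (Gj k s (j + 1) c) hnot]
    -- termwise identity
    have hterm : ∀ φ ∈ Fintype.piFinset (fun a => if a ∈ Yj k j then (Finset.univ : Finset (Fin (k + 1) ⊕ Fin k)) else {a}),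
        (∏ b ∈ Yj k j, pw k s b (φ b)) *
          ∑ q : Fin (k + 1) ⊕ Fin k, pw k s (Sum.inl (⟨j, by omega⟩ : Fin (k + 1))) q * Gj k s (j + 1) c (insert q ((Yj k j).image φ)) =
        (∏ b ∈ Yj k j, pw k s b (φ b)) * Gj k s j c ((Yj k j).image φ) +
          (s * -((-s) ^ (c - j))) * ((∏ b ∈ Yj k j, pw k s b (φ b)) * Gj k s j (j - 1) ((Yj k j).image φ)) := by
      intro φ _
      by_cases hw : ∏ b ∈ Yj k j, pw k s b (φ b) = 0
      · rw [hw]; ring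
      obtain ⟨hRY, hRX⟩ := image_Yj_support hw
      have hRcard : ((Yj k j).image φ).card ≤ j := by
        refine Finset.card_image_le.trans ?_
        unfold Yj
        refine Finset.card_image_le.trans ?_
        rw [Fin.card_filter_val_lt]; omega
      set R := (Yj k j).image φ with hR
      rw [Fintype.sum_sum_type]
      -- Y-sources: `inl j` (killed) and `inl (j-1)` (weight `s`)
      have hY : ∑ b : Fin (k + 1), pw k s (Sum.inl (⟨j, by omega⟩ : Fin (k + 1))) (Sum.inl b) * Gj k s (j + 1) c (insert (Sum.inl b) R) =
          s * (-((-s) ^ (c - j)) * Gj k s j (j - 1) R) := by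
        rw [← Finset.add_sum_erase _ _ (Finset.mem_univ (⟨j - 1, by omega⟩ : Fin (k + 1)))]
        have h1 : pw k s (Sum.inl (⟨j, by omega⟩ : Fin (k + 1))) (Sum.inl (⟨j - 1, by omega⟩ : Fin (k + 1))) = s := by
          simp only [pw]
          rw [if_neg (by simp [Fin.ext_iff]; omega), if_pos (Nat.sub_add_cancel hj)]
        rw [h1, Gj_insert_inl_pred hj hjk' hc hRX hRY hRcard]
        have hrest : ∑ b ∈ Finset.univ.erase (⟨j - 1, by omega⟩ : Fin (k + 1)),
            pw k s (Sum.inl (⟨j, by omega⟩ : Fin (k + 1))) (Sum.inl b) * Gj k s (j + 1) c (insert (Sum.inl b) R) = 0 := by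
          refine Finset.sum_eq_zero fun b hb => ?_
          have hb' : b ≠ ⟨j - 1, by omega⟩ := (Finset.mem_erase.1 hb).1
          simp only [pw]
          by_cases hbj : b = ⟨j, by omega⟩
          · rw [hbj, if_pos rfl, one_mul]
            exact Gj_insert_inl_self hj hjk' hc hRX hRY hRcard
          · rw [if_neg hbj, if_neg, zero_mul]
            intro h
            apply hb'
            ext; simp at h ⊢; omega
        rw [hrest, add_zero]
      -- X-sources: only the index of level `j`
      have hX : ∑ i : Fin k, pw k s (Sum.inl (⟨j, by omega⟩ : Fin (k + 1))) (Sum.inr i) * Gj k s (j + 1) c (insert (Sum.inr i) R) =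
          Gj k s j c R := by
        rw [Finset.sum_eq_single (⟨j + 1, hjk'⟩ : Fin k)]
        · simp only [pw]
          rw [if_pos (by simp [lvlX]), one_mul, Gj_insert_idx hj hjk']
        · intro i _ hi
          simp only [pw]
          rw [if_neg, zero_mul]
          rw [lvlX_eq_iff_of_pos hj]
          intro h; apply hi; ext; exact h
        · intro h; exact (h (Finset.mem_univ _)).elim
      rw [hY, hX]
      ring
    rw [Finset.sum_congr rfl hterm, Finset.sum_add_distrib, ← Finset.mul_sum, ih (by omega) c (by omega),
      ih (by omega) (j - 1) le_rfl]
    have hpow : (-s) ^ c = (-s) * ((-s) ^ (c - j) * (-s) ^ (j - 1)) := by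
      rw [← pow_add, ← pow_succ']; congr 1; omega
    rw [hpow]; ring

/-- **the top coordinate**: for `R` without `inl k`, `Σ_q pw (inl k) q · zk (R + q) = s · [inl (k−1) ∈ R] · zk R`. -/
theorem top_sum (hk : 1 ≤ k) {R : Finset (Fin (k + 1) ⊕ Fin k)} (hRY : ∀ b : Fin (k + 1), Sum.inl b ∈ R → (b : ℕ) < k) :
    ∑ q : Fin (k + 1) ⊕ Fin k, pw k s (Sum.inl (Fin.last k)) q * zk k s (insert q R) =
      s * (if Sum.inl (⟨k - 1, by omega⟩ : Fin (k + 1)) ∈ R then zk k s R else 0) := by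
  classical
  have hlast : Sum.inl (Fin.last k) ∉ R := fun h => by have := hRY _ h; simp at this
  by_cases hcard : R.card + 1 = k
  · rw [zk_local hcard (Fin.last k) (fun b hb => Fin.lt_def.2 (by simpa using hRY b hb))]
    split_ifs
    · rw [zk_card_ne (by omega), mul_zero]
    · rw [mul_zero]
  · rw [Fintype.sum_sum_type]
    have hX : ∑ i : Fin k, pw k s (Sum.inl (Fin.last k)) (Sum.inr i) * zk k s (insert (Sum.inr i) R) = 0 := by
      refine Finset.sum_eq_zero fun i _ => ?_
      simp only [pw]
      rw [if_neg, zero_mul]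
      simp only [lvlX, Fin.val_last]; omega
    have hY : ∀ b : Fin (k + 1), pw k s (Sum.inl (Fin.last k)) (Sum.inl b) * zk k s (insert (Sum.inl b) R) =
        if b = ⟨k - 1, by omega⟩ then s * (if Sum.inl (⟨k - 1, by omega⟩ : Fin (k + 1)) ∈ R then zk k s R else 0) else 0 := by
      intro b
      simp only [pw]
      by_cases hb : b = Fin.last k
      · subst hb
        rw [if_pos rfl, one_mul, zk_card_ne (by rw [Finset.card_insert_of_notMem hlast]; exact hcard), if_neg]
        simp [Fin.ext_iff]; omega
      · rw [if_neg hb]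
        by_cases hb' : b = ⟨k - 1, by omega⟩
        · subst hb'
          rw [if_pos (by simp; omega), if_pos rfl]
          congr 1
          split_ifs with hmem
          · rw [Finset.insert_eq_of_mem hmem]
          · exact zk_card_ne (by rw [Finset.card_insert_of_notMem hmem]; exact hcard)
        · rw [if_neg, if_neg hb', zero_mul]
          intro h; apply hb'; ext; simp [Fin.ext_iff] at hb h ⊢; omega
    rw [hX, add_zero, Finset.sum_congr rfl fun b _ => hY b, Finset.sum_ite_eq', if_pos (Finset.mem_univ _)]

/-- at the top level `j = k − 1`: `zk (R + inl (k−1)) = Gj (k−1) (k−1) R` for `R` with Y-values `< k − 1`. -/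
theorem zk_insert_eq_Gj (hk : 2 ≤ k) {R : Finset (Fin (k + 1) ⊕ Fin k)}
    (hRY : ∀ b : Fin (k + 1), Sum.inl b ∈ R → (b : ℕ) < k - 1) :
    zk k s (insert (Sum.inl (⟨k - 1, by omega⟩ : Fin (k + 1))) R) = Gj k s (k - 1) (k - 1) R := by
  have hX : Xlt k (k - 1) = Finset.univ := by
    ext i; simp only [Xlt, lvlX, Finset.mem_filter, Finset.mem_univ, true_and, iff_true]; omega
  have hRX : R.toRight ⊆ Xlt k (k - 1) := by rw [hX]; exact Finset.subset_univ _
  have hmem : Sum.inl (⟨k - 1, by omega⟩ : Fin (k + 1)) ∉ R := fun h => by have := hRY _ h; simp at this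
  have hL : Lj k (k - 1) R = Lset k R := by simp only [Lj, Lset, hX]
  by_cases hcard : R.card + 1 = k
  · by_cases hg : ((Finset.univ : Finset (Fin k)) \ R.toRight).card = (Lset k R).card
    · rw [zk_insert_inl hcard hg]
      unfold Gj
      rw [if_pos (by rw [hX, hL]; exact hg), hL]
    · have h1 : zk k s (insert (Sum.inl (⟨k - 1, by omega⟩ : Fin (k + 1))) R) = 0 := by
        simp only [zk]
        rw [if_neg]
        rintro ⟨-, hg'⟩
        apply hg
        simpa [Lset] using hg'
      have h2 : Gj k s (k - 1) (k - 1) R = 0 := by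
        unfold Gj; rw [if_neg]; rw [hX, hL]; exact hg
      rw [h1, h2]
  · rw [zk_card_ne (by rw [Finset.card_insert_of_notMem hmem]; exact hcard)]
    symm
    refine Gj_card_ne (by omega) (by omega) hRX (fun h => ?_) (by omega)
    obtain ⟨b, hb, hbv⟩ := mem_Aset.1 h
    have := hRY b hb; omega

/-- ★ **THEOREM B** (memo §3): the staircase functional does NOT annihilate the row `Y`:
`Σ_{φ ∈ maps Y} wt(φ) · zk (Y.image φ) = s · (−2^{k−1} (−s)^{k−1}) ≠ 0`. -/
theorem lambda_Y_ne_zero (hk : 2 ≤ k) (hs : s ≠ 0) :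
    ∑ φ ∈ Fintype.piFinset (fun a => if a ∈ (Finset.univ : Finset (Fin (k + 1))).image Sum.inl
        then (Finset.univ : Finset (Fin (k + 1) ⊕ Fin k)) else {a}),
      (∏ a ∈ (Finset.univ : Finset (Fin (k + 1))).image Sum.inl, pw k s a (φ a)) *
        zk k s (((Finset.univ : Finset (Fin (k + 1))).image Sum.inl).image φ) ≠ 0 := by
  classical
  have hY : (Finset.univ : Finset (Fin (k + 1))).image (Sum.inl : Fin (k + 1) → Fin (k + 1) ⊕ Fin k) = Yj k (k + 1) := by
    ext x; simp only [Finset.mem_image, Finset.mem_univ, true_and, mem_Yj]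
    constructor
    · rintro ⟨b, rfl⟩; exact ⟨b, b.isLt, rfl⟩
    · rintro ⟨b, -, rfl⟩; exact ⟨b, rfl⟩
  rw [hY]
  -- peel `inl k`
  obtain ⟨hY1, hn1⟩ := Yj_succ (k := k) (j := k) le_rfl
  have hlast : (⟨k, by omega⟩ : Fin (k + 1)) = Fin.last k := rfl
  rw [hlast] at hY1 hn1
  rw [hY1, sum_maps_insert (pw k s) (zk k s) hn1]
  have hstep1 : ∀ φ ∈ Fintype.piFinset (fun a => if a ∈ Yj k k then (Finset.univ : Finset (Fin (k + 1) ⊕ Fin k)) else {a}),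
      (∏ b ∈ Yj k k, pw k s b (φ b)) * ∑ q : Fin (k + 1) ⊕ Fin k, pw k s (Sum.inl (Fin.last k)) q * zk k s (insert q ((Yj k k).image φ)) =
      s * ((∏ b ∈ Yj k k, pw k s b (φ b)) *
        (if Sum.inl (⟨k - 1, by omega⟩ : Fin (k + 1)) ∈ (Yj k k).image φ then zk k s ((Yj k k).image φ) else 0)) := by
    intro φ _
    by_cases hw : ∏ b ∈ Yj k k, pw k s b (φ b) = 0
    · rw [hw]; ring
    · rw [top_sum (by omega) (image_Yj_support hw).1]; ring
  rw [Finset.sum_congr rfl hstep1, ← Finset.mul_sum]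
  -- peel `inl (k-1)`
  obtain ⟨hY2, hn2⟩ := Yj_succ (k := k) (j := k - 1) (by omega)
  have hkk : k - 1 + 1 = k := by omega
  rw [hkk] at hY2
  rw [hY2, sum_maps_insert (pw k s) (fun R => if Sum.inl (⟨k - 1, by omega⟩ : Fin (k + 1)) ∈ R then zk k s R else 0) hn2]
  have hstep2 : ∀ φ ∈ Fintype.piFinset (fun a => if a ∈ Yj k (k - 1) then (Finset.univ : Finset (Fin (k + 1) ⊕ Fin k)) else {a}),
      (∏ b ∈ Yj k (k - 1), pw k s b (φ b)) *
        ∑ q : Fin (k + 1) ⊕ Fin k, pw k s (Sum.inl (⟨k - 1, by omega⟩ : Fin (k + 1))) q *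
          (if Sum.inl (⟨k - 1, by omega⟩ : Fin (k + 1)) ∈ insert q ((Yj k (k - 1)).image φ)
            then zk k s (insert q ((Yj k (k - 1)).image φ)) else 0) =
      (∏ b ∈ Yj k (k - 1), pw k s b (φ b)) * Gj k s (k - 1) (k - 1) ((Yj k (k - 1)).image φ) := by
    intro φ _
    by_cases hw : ∏ b ∈ Yj k (k - 1), pw k s b (φ b) = 0
    · rw [hw, zero_mul, zero_mul]
    · obtain ⟨hRY, -⟩ := image_Yj_support hw
      have hnot : Sum.inl (⟨k - 1, by omega⟩ : Fin (k + 1)) ∉ (Yj k (k - 1)).image φ := fun h => by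
        have := hRY _ h; simp at this
      congr 1
      rw [Finset.sum_eq_single (Sum.inl (⟨k - 1, by omega⟩ : Fin (k + 1)))]
      · rw [if_pos (Finset.mem_insert_self _ _), pw_self, one_mul, zk_insert_eq_Gj hk hRY]
      · intro q _ hq
        rw [if_neg, mul_zero]
        rw [Finset.mem_insert, not_or]
        exact ⟨fun h => hq h.symm, hnot⟩
      · intro h; exact (h (Finset.mem_univ _)).elim
  rw [Finset.sum_congr rfl hstep2, omega_eq hk (k - 1) (by omega) (by omega) (k - 1) (by omega)]
  have h2 : (2 : ℂ) ^ (k - 1) ≠ 0 := pow_ne_zero _ two_ne_zero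
  have h3 : (-s) ^ (k - 1) ≠ 0 := pow_ne_zero _ (neg_ne_zero.2 hs)
  intro h
  rw [mul_eq_zero, mul_eq_zero, neg_eq_zero] at h
  rcases h with h | h | h
  · exact hs h
  · exact h2 h
  · exact h3 h

/-- ★★ **`P_k` IS GOOD FOR EVERY `k ≥ 2`** (memo val-np-p6 g16 §3, Corollary): with the path table, every square matrix whose rows
are an injective enumeration of the monomials `U = {|S| ≤ k, S ≠ X} ∪ {Y}` and whose columns run through all the points `|J| ≤ k`
has NONZERO DETERMINANT (`s ≠ 0`). -/
theorem pathTable_det_ne_zero (hk : 2 ≤ k) (hs : s ≠ 0) {r : ℕ}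
    (rowS colJ : Fin r → Finset (Fin (k + 1) ⊕ Fin k)) (hinj : Function.Injective rowS)
    (hrow : ∀ i, ((rowS i).card ≤ k ∧ rowS i ≠ (Finset.univ : Finset (Fin k)).image Sum.inr) ∨
      rowS i = (Finset.univ : Finset (Fin (k + 1))).image Sum.inl)
    (hcol : ∀ J : Finset (Fin (k + 1) ⊕ Fin k), J.card ≤ k → ∃ kk, colJ kk = J) :
    (Matrix.of fun i kk : Fin r => ∏ a ∈ rowS i, ∑ q ∈ colJ kk, pw k s a q).det ≠ 0 :=
  det_ne_zero_of_dual (pw k s) (ppot k) (pw_ne_zero k s) (pw_self k s) k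
    ((Finset.univ : Finset (Fin k)).image Sum.inr) ((Finset.univ : Finset (Fin (k + 1))).image Sum.inl) (zk k s)
    (fun R hR => zk_card_ne (by omega)) (fun S hS hX => lambda_row_eq_zero S hS hX) (lambda_Y_ne_zero hk hs)
    rowS colJ hinj hrow hcol


end PathTable

end

end Summit.ValiantsHypothesis.ValiantsHypothesis.Theorems.BarrierLever.HiddenStates
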